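import Mathlib.GroupTheory.SemidirectProduct
import Mathlib.Algebra.Group.Action.End
import Mathlib.GroupTheory.OrderOfElement
import Mathlib.Tactic.Group
import HarnessLib

/-!
# Extending a 1-cocycle along `Π = N ⋊ σ₀^ℤ` (the `Z`-action of [EtTh] Prop 1.5 (iii) at the cocycle level)

S. Mochizuki, *The étale theta function …*, Publ. RIMS **45** (2009) [EtTh], §1 p. 12 («`Π^tp_X/Π^tp_Y ≅ Z (≅ ℤ)`»),
Prop 1.5 (iii) p. 23 (the action of `a ∈ Z ≅ Π^tp_X/Π^tp_Y` on the classes); the group cohomology is that of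
J. Neukirch, A. Schmidt, K. Wingberg, *Cohomology of Number Fields*, I §2 (crossed homomorphisms = splittings of the
split extension `M ⋊ Π → Π`) [cite: NeukirchSchmidtWingberg2008, I §2 and II §7].

abc-iut cell, layer L2, seat abc-iut-L2-t12 (gen 8), row (β) «NV TWIN of p458029» — part 2/3 (pure group theory,
PROOF-ONLY: no definition, no instance, no `Prop` fact). For a group `Π` acting on a commutative group `M`, a
surjection `a : Π ↠ ℤ` with kernel `N` and `σ₀` with `a(σ₀) = 1` (so `Π = N ⋊ σ₀^ℤ`), a crossed homomorphism
`φ : N → M` extends to a crossed homomorphism `c : Π → M` with `c(σ₀) = m` as soon as the single compatibility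
`φ(σ₀ n σ₀⁻¹) = m · σ₀·φ(n) · ((σ₀ n σ₀⁻¹)·m)⁻¹` holds (`exists_crossedHom_extension_of_zpowers`). Proof: crossed
homomorphisms are sections of `M ⋊ Π ↠ Π`; build the section on the external `N ⋊ ℤ` with `SemidirectProduct.lift`
from `n ↦ (φ n, n)` and `k ↦ (m, σ₀)^k`, the compatibility at `k = 1` propagating to all `k ∈ ℤ`. This is the step
«the cocycle on `Π^tp_Y` + its conjugation law under the deck generator ⇒ a cocycle on `Π^tp_X`» used by part 3 to
produce the exponent cocycle of part 1 (`ThetaKummerInputOfExponentCocycle`) at the stage-2 model. Nothing of [EtTh]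
is asserted; no side is taken on [IUTchIII] Cor 3.12.
-/

namespace Literature.AnabelianGeometry.EtaleTheta

namespace CrossedHomExtension

variable {P : Type*} [Group P] {M : Type*} [CommGroup M] [MulDistribMulAction P M]

/-- The compatibility `f₁ ∘ θ(k) = conj(f₂ k) ∘ f₁` required by `SemidirectProduct.lift` over `ℤ` holds for every
`k` as soon as it holds at the generator `k = 1` (the set of good `k` is a subgroup).
[cite: NeukirchSchmidtWingberg2008, I §2 and II §7] -/
private theorem lift_compat_of_generator {N H : Type*} [Group N] [Group H] (θ : Multiplicative ℤ →* MulAut N)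
    (f₁ : N →* H) (f₂ : Multiplicative ℤ →* H)
    (h1 : f₁.comp (θ (Multiplicative.ofAdd 1)).toMonoidHom =
      (MulAut.conj (f₂ (Multiplicative.ofAdd 1))).toMonoidHom.comp f₁) :
    ∀ k, f₁.comp (θ k).toMonoidHom = (MulAut.conj (f₂ k)).toMonoidHom.comp f₁ := by
  -- pointwise form
  have P_iff : ∀ k, (f₁.comp (θ k).toMonoidHom = (MulAut.conj (f₂ k)).toMonoidHom.comp f₁) ↔
      ∀ n, f₁ (θ k n) = f₂ k * f₁ n * (f₂ k)⁻¹ := by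
    intro k
    constructor
    · intro h n
      have := DFunLike.congr_fun h n
      simpa using this
    · intro h
      ext n
      simpa using h n
  have hmul : ∀ k k', (∀ n, f₁ (θ k n) = f₂ k * f₁ n * (f₂ k)⁻¹) → (∀ n, f₁ (θ k' n) = f₂ k' * f₁ n * (f₂ k')⁻¹) →
      ∀ n, f₁ (θ (k * k') n) = f₂ (k * k') * f₁ n * (f₂ (k * k'))⁻¹ := by
    intro k k' hk hk' n
    rw [map_mul, MulAut.mul_apply, hk, hk', map_mul, mul_inv_rev]
    group
  have hinv : ∀ k, (∀ n, f₁ (θ k n) = f₂ k * f₁ n * (f₂ k)⁻¹) → ∀ n, f₁ (θ k⁻¹ n) = f₂ k⁻¹ * f₁ n * (f₂ k⁻¹)⁻¹ := by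
    intro k hk n
    have h := hk (θ k⁻¹ n)
    rw [← MulAut.mul_apply, ← map_mul, mul_inv_cancel, map_one, MulAut.one_apply] at h
    rw [show f₂ k⁻¹ = (f₂ k)⁻¹ from map_inv f₂ k, inv_inv, h]
    group
  have h1' := (P_iff _).mp h1
  intro k
  rw [P_iff]
  induction k using Multiplicative.rec with
  | ofAdd z =>
    induction z using Int.induction_on with
    | zero => intro n; rw [ofAdd_zero, map_one, map_one, MulAut.one_apply, one_mul, inv_one, mul_one]
    | succ z ih => rw [ofAdd_add]; exact hmul _ _ ih h1'
    | pred z ih => rw [sub_eq_add_neg, ofAdd_add, ofAdd_neg]; exact hmul _ _ ih (hinv _ h1')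

/-- **Cocycle extension along `P = N ⋊ σ₀^ℤ`.** Let `P` act on the commutative group `M`, let `a : P → ℤ` be a
homomorphism with kernel `N` and `σ₀ ∈ P` with `a(σ₀) = 1`. A crossed homomorphism `φ` on `N`
(`φ(n n′) = φ(n) · n·φ(n′)`) and an element `m ∈ M` satisfying the ONE compatibility
`φ(σ₀ n σ₀⁻¹) = m · σ₀·φ(n) · ((σ₀ n σ₀⁻¹)·m)⁻¹` (`n ∈ N`) extend to a crossed homomorphism `c : P → M`
(`c(g h) = c(g) · g·c(h)`) with `c|_N = φ` and `c(σ₀) = m` — the value at the deck generator and the cocycle on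
`Π^tp_Y` determine the cocycle on `Π^tp_X` (the `Z`-action of Prop 1.5 (iii) read at cocycle level).
[cite: NeukirchSchmidtWingberg2008, I §2 and II §7] -/
theorem exists_crossedHom_extension_of_zpowers (a : P →* Multiplicative ℤ) (σ₀ : P)
    (hσ₀ : a σ₀ = Multiplicative.ofAdd 1) (φ : P → M)
    (hφ : ∀ n ∈ a.ker, ∀ n' ∈ a.ker, φ (n * n') = φ n * n • φ n') (m : M)
    (hcompat : ∀ n ∈ a.ker, φ (σ₀ * n * σ₀⁻¹) = m * σ₀ • φ n * ((σ₀ * n * σ₀⁻¹) • m)⁻¹) :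
    ∃ c : P → M, (∀ g h : P, c (g * h) = c g * g • c h) ∧ (∀ n ∈ a.ker, c n = φ n) ∧ c σ₀ = m := by
  classical
  -- the internal description `P = N ⋊ σ₀^ℤ`
  let N : Subgroup P := a.ker
  haveI : N.Normal := inferInstanceAs a.ker.Normal
  let θ : Multiplicative ℤ →* MulAut N := (MulAut.conjNormal (H := N)).comp (zpowersHom P σ₀)
  have θ_apply : ∀ (k : Multiplicative ℤ) (n : N), ((θ k n : N) : P) = σ₀ ^ Multiplicative.toAdd k * n *
      (σ₀ ^ Multiplicative.toAdd k)⁻¹ := fun k n => by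
    show ((MulAut.conjNormal (zpowersHom P σ₀ k) n : N) : P) = _
    rw [MulAut.conjNormal_apply, zpowersHom_apply]
  -- `e : N ⋊ ℤ → P`, `(n, k) ↦ n σ₀^k`
  have compat_e : ∀ k, N.subtype.comp (θ k).toMonoidHom =
      (MulAut.conj (zpowersHom P σ₀ k)).toMonoidHom.comp N.subtype := by
    intro k; ext n
    simp only [MonoidHom.comp_apply, MulEquiv.coe_toMonoidHom, Subgroup.coe_subtype, MulAut.conj_apply,
      zpowersHom_apply, θ_apply]
  let e : N ⋊[θ] Multiplicative ℤ →* P := SemidirectProduct.lift N.subtype (zpowersHom P σ₀) compat_e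
  have e_apply : ∀ x : N ⋊[θ] Multiplicative ℤ, e x = (x.left : P) * σ₀ ^ Multiplicative.toAdd x.right :=
    fun x => by
    show N.subtype x.left * zpowersHom P σ₀ x.right = _
    rw [Subgroup.coe_subtype, zpowersHom_apply]
  have a_zpow : ∀ k : ℤ, a (σ₀ ^ k) = Multiplicative.ofAdd k := fun k => by
    rw [map_zpow, hσ₀, ← ofAdd_zsmul, smul_eq_mul, mul_one]
  have a_e : ∀ x : N ⋊[θ] Multiplicative ℤ, a (e x) = x.right := fun x => by
    rw [e_apply, map_mul, show a (x.left : P) = 1 from x.left.2, one_mul, a_zpow, ofAdd_toAdd]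
  -- the inverse map
  let dec : P → N ⋊[θ] Multiplicative ℤ := fun g =>
    ⟨⟨g * (σ₀ ^ Multiplicative.toAdd (a g))⁻¹, by
      show a (g * (σ₀ ^ Multiplicative.toAdd (a g))⁻¹) = 1
      rw [map_mul, map_inv, a_zpow, ofAdd_toAdd, mul_inv_cancel]⟩, a g⟩
  have e_dec : ∀ g, e (dec g) = g := fun g => by
    rw [e_apply]
    show g * (σ₀ ^ Multiplicative.toAdd (a g))⁻¹ * σ₀ ^ Multiplicative.toAdd (a g) = g
    rw [inv_mul_cancel_right]
  have dec_e : ∀ x, dec (e x) = x := fun x => by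
    apply SemidirectProduct.ext
    · apply Subtype.ext
      show e x * (σ₀ ^ Multiplicative.toAdd (a (e x)))⁻¹ = x.left
      rw [a_e, e_apply, mul_inv_cancel_right]
    · show a (e x) = x.right
      exact a_e x
  have dec_mul : ∀ g h, dec (g * h) = dec g * dec h := fun g h => by
    have : e (dec (g * h)) = e (dec g * dec h) := by rw [map_mul, e_dec, e_dec, e_dec]
    rw [← dec_e (dec g * dec h), ← this, dec_e]
  -- the section on `N ⋊ ℤ` with values in `M ⋊ P`
  let ψ : P →* MulAut M := MulDistribMulAction.toMulAut P M
  have ψ_apply : ∀ (g : P) (x : M), ψ g x = g • x := fun _ _ => rfl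
  let sN : N →* M ⋊[ψ] P :=
    { toFun := fun n => ⟨φ n, n⟩
      map_one' := by
        have h := hφ 1 (one_mem _) 1 (one_mem _)
        rw [one_mul, one_smul] at h
        ext
        · exact mul_eq_left.mp h.symm
        · rfl
      map_mul' := fun n n' => by
        ext
        · show φ ((n : P) * n') = φ n * ψ (n : P) (φ n')
          rw [ψ_apply]; exact hφ n n.2 n' n'.2
        · rfl }
  have sN_apply_left : ∀ n : N, (sN n).left = φ n := fun _ => rfl
  have sN_apply_right : ∀ n : N, (sN n).right = (n : P) := fun _ => rfl
  let st : M ⋊[ψ] P := ⟨m, σ₀⟩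
  let sZ : Multiplicative ℤ →* M ⋊[ψ] P := zpowersHom (M ⋊[ψ] P) st
  have compat_s : ∀ k, sN.comp (θ k).toMonoidHom = (MulAut.conj (sZ k)).toMonoidHom.comp sN := by
    apply lift_compat_of_generator
    ext n
    · -- left components: the compatibility hypothesis
      simp only [MonoidHom.comp_apply, MulEquiv.coe_toMonoidHom, MulAut.conj_apply]
      rw [show sZ (Multiplicative.ofAdd 1) = st from by
        show zpowersHom (M ⋊[ψ] P) st (Multiplicative.ofAdd 1) = st
        rw [zpowersHom_apply, toAdd_ofAdd, zpow_one]]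
      show φ ((θ (Multiplicative.ofAdd 1) n : N) : P) = m * ψ σ₀ (φ n) * ψ (σ₀ * n) (ψ σ₀⁻¹ m⁻¹)
      have hn : ((θ (Multiplicative.ofAdd 1) n : N) : P) = σ₀ * n * σ₀⁻¹ := by
        rw [θ_apply, toAdd_ofAdd, zpow_one]
      rw [hn, hcompat n n.2, ← MulAut.mul_apply, ← map_mul, ψ_apply, ψ_apply, smul_inv']
    · -- right components: `σ₀ n σ₀⁻¹`
      simp only [MonoidHom.comp_apply, MulEquiv.coe_toMonoidHom, MulAut.conj_apply]
      rw [show sZ (Multiplicative.ofAdd 1) = st from by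
        show zpowersHom (M ⋊[ψ] P) st (Multiplicative.ofAdd 1) = st
        rw [zpowersHom_apply, toAdd_ofAdd, zpow_one]]
      show ((θ (Multiplicative.ofAdd 1) n : N) : P) = σ₀ * n * σ₀⁻¹
      rw [θ_apply, toAdd_ofAdd, zpow_one]
  let F : N ⋊[θ] Multiplicative ℤ →* M ⋊[ψ] P := SemidirectProduct.lift sN sZ compat_s
  -- `F` lies over `e`
  have F_right : ∀ x, (F x).right = e x := by
    intro x
    have hx := SemidirectProduct.inl_left_mul_inr_right x
    conv_lhs => rw [← hx]
    rw [map_mul, SemidirectProduct.lift_inl, SemidirectProduct.lift_inr, SemidirectProduct.mul_right, sN_apply_right,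
      e_apply]
    show (x.left : P) * SemidirectProduct.rightHom (zpowersHom (M ⋊[ψ] P) st x.right) = _
    rw [zpowersHom_apply, map_zpow]
    rfl
  -- the extension
  refine ⟨fun g => (F (dec g)).left, fun g h => ?_, fun n hn => ?_, ?_⟩
  · show (F (dec (g * h))).left = (F (dec g)).left * g • (F (dec h)).left
    rw [dec_mul, map_mul, SemidirectProduct.mul_left, F_right, e_dec, ψ_apply]
  · have hdec : dec n = SemidirectProduct.inl ⟨n, hn⟩ := by
      rw [← dec_e (SemidirectProduct.inl ⟨n, hn⟩)]
      congr 1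
      rw [e_apply, SemidirectProduct.left_inl, SemidirectProduct.right_inl, toAdd_one, zpow_zero, mul_one]
    show (F (dec n)).left = φ n
    rw [hdec, SemidirectProduct.lift_inl, sN_apply_left]
  · have hdec : dec σ₀ = SemidirectProduct.inr (Multiplicative.ofAdd 1) := by
      rw [← dec_e (SemidirectProduct.inr (Multiplicative.ofAdd 1))]
      congr 1
      rw [e_apply, SemidirectProduct.left_inr, SemidirectProduct.right_inr, toAdd_ofAdd, zpow_one,
        OneMemClass.coe_one, one_mul]
    show (F (dec σ₀)).left = m
    rw [hdec, SemidirectProduct.lift_inr]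
    show (zpowersHom (M ⋊[ψ] P) st (Multiplicative.ofAdd 1)).left = m
    rw [zpowersHom_apply, toAdd_ofAdd, zpow_one]

end CrossedHomExtension

end Literature.AnabelianGeometry.EtaleTheta
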